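import Mathlib.MeasureTheory.Function.Jacobian
import Literature.Topology.FourManifolds.MMSWPictureGeneralPosition
import HarnessLib

/-!
# Generic bands for the strip twists of a model knot

Sibling of `MMSWStripTwist.lean` (offset bands `{|Re z - c_j - e_j| < w, Im z > 0}`,
`|e_j| + w < 1`) and `MMSWPictureGeneralPosition.lean` (general position of the standard
picture), towards the named fact
`Literature.Topology.FourManifolds.MMSW.eventually_approxHasRasmussen` (Manolescu–Marengon–
Sarkar–Willis, arXiv:1910.08195, Thm. 1.4 / Prop. 8.2 (i)).  In the standard (annular) picture of
`M_r ∖ {cores}` the band above hole `j` is seen as the thin ring of planar radii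
`C_r + c_j + e_j ± w`; to read off the Gauss diagram of the strip-twisted pictures one wants the
ring to meet the diagram `D(0⃗)(K)` in radially monotone arcs containing no crossing, i.e. the
window `[c_j + e_j - w, c_j + e_j + w]` of values of `Re z` along the knot must avoid

* the finitely many values of `Re z` at the crossings of `D(0⃗)(K)` (`Knot.crossingSet`), and
* the critical values of `θ ↦ Re z(K(cos θ, sin θ))` — a compact Lebesgue-null set (Sard's
  theorem in dimension one, from Mathlib's change-of-variables inequality
  `MeasureTheory.addHaar_image_eq_zero_of_det_fderivWithin_eq_zero`).

**Such bands exist** (`exists_generic_bands`): a closed null set misses a point of every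
interval `(c_j - 1/2, c_j + 1/2)`, hence a whole window about it (`exists_bands_avoiding`).
Everything is proved; no definitions, no named facts.

## References

* C. Manolescu, M. Marengon, S. Sarkar, M. Willis, Duke Math. J. 172 (2023), arXiv:1910.08195,
  §8.1 (general position of the link in the standard picture). [ManolescuMarengonSarkarWillis2023]
* A. Sard, *The measure of the critical values of differentiable maps*, Bull. AMS 48 (1942)
  883–890 (dimension one). [folklore]
-/

open scoped Manifold ContDiff Topology
open Function Set MeasureTheory

noncomputable section

namespace Literature.Topology.FourManifolds

/-- Local notation: `𝔼 n` is the model Euclidean space `EuclideanSpace ℝ (Fin n)`. -/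
local notation "𝔼 " n:arg => EuclideanSpace ℝ (Fin n)

/-- Local notation: `𝕊 n` is the unit sphere in `EuclideanSpace ℝ (Fin (n + 1))`. -/
local notation "𝕊 " n:arg => (Metric.sphere (0 : EuclideanSpace ℝ (Fin (n + 1))) 1)

namespace MMSW

open Literature.AlgebraicTopology.Homotopy.HopfFibration (zC wC)

variable {r : ℕ}

/-! ## Sard in dimension one, and windows avoiding a closed null set -/

/-- **Sard's theorem on the line**: the critical values of a differentiable `f : ℝ → ℝ` form a
Lebesgue-null set. [folklore] -/
theorem volume_image_setOf_deriv_eq_zero {f : ℝ → ℝ} (hf : Differentiable ℝ f) :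
    volume (f '' {x | deriv f x = 0}) = 0 := by
  refine addHaar_image_eq_zero_of_det_fderivWithin_eq_zero volume
    (f' := fun x ↦ ContinuousLinearMap.toSpanSingleton ℝ (deriv f x)) (fun x _ ↦ ?_) (fun x hx ↦ ?_)
  · exact (hasDerivWithinAt_iff_hasFDerivWithinAt.1 (hf x).hasDerivAt.hasDerivWithinAt)
  · rw [ContinuousLinearMap.det_toSpanSingleton]
    exact hx

/-- A Lebesgue-null set misses a point of every nondegenerate open interval. [folklore] -/
theorem exists_mem_Ioo_notMem_of_volume_eq_zero {S : Set ℝ} (hS : volume S = 0) {a b : ℝ}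
    (hab : a < b) : ∃ p ∈ Ioo a b, p ∉ S := by
  by_contra h
  push Not at h
  have hsub : Ioo a b ⊆ S := fun p hp ↦ h p hp
  have h1 : volume (Ioo a b) ≤ volume S := measure_mono hsub
  rw [hS, Real.volume_Ioo, nonpos_iff_eq_zero, ENNReal.ofReal_eq_zero] at h1
  linarith

/-- **Windows avoiding a closed null set**: for finitely many centres `c_j` there are offsets
`|e_j| < 1/2` and a common half-width `0 < w ≤ 1/4` (so `|e_j| + w < 1`) such that every window
`[c_j + e_j - w, c_j + e_j + w]` misses the closed Lebesgue-null set `S`. [folklore] -/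
theorem exists_bands_avoiding (c : Fin r → ℝ) {S : Set ℝ} (hS : IsClosed S) (hS0 : volume S = 0) :
    ∃ (w : ℝ) (e : Fin r → ℝ), 0 < w ∧ (∀ j, |e j| + w < 1) ∧
      ∀ j, ∀ x ∈ Icc (c j + e j - w) (c j + e j + w), x ∉ S := by
  -- a point of `(c_j - 1/2, c_j + 1/2)` off `S`, and a ball about it off `S`
  have hp : ∀ j : Fin r, ∃ p δ : ℝ, p ∈ Ioo (c j - 1 / 2) (c j + 1 / 2) ∧ 0 < δ ∧
      ∀ x, dist x p < δ → x ∉ S := by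
    intro j
    obtain ⟨p, hpI, hpS⟩ := exists_mem_Ioo_notMem_of_volume_eq_zero hS0
      (show c j - 1 / 2 < c j + 1 / 2 by linarith)
    obtain ⟨δ, hδ, hball⟩ := Metric.isOpen_iff.1 hS.isOpen_compl p hpS
    exact ⟨p, δ, hpI, hδ, fun x hx hxS ↦ hball (Metric.mem_ball.2 hx) hxS⟩
  choose p δ hpI hδ hoff using hp
  -- a common half-width below all `δ_j` and `1/4`
  obtain ⟨w, hw0, hw4, hwδ⟩ : ∃ w : ℝ, 0 < w ∧ w ≤ 1 / 4 ∧ ∀ j, w < δ j := by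
    rcases isEmpty_or_nonempty (Fin r) with hr | hr
    · exact ⟨1 / 4, by norm_num, le_rfl, fun j ↦ (IsEmpty.false j).elim⟩
    · have hne : (Finset.univ : Finset (Fin r)).Nonempty := Finset.univ_nonempty
      set m : ℝ := Finset.univ.inf' hne δ with hm
      have hmpos : 0 < m := (Finset.lt_inf'_iff hne).2 fun j _ ↦ hδ j
      refine ⟨min (1 / 4) (m / 2), lt_min (by norm_num) (half_pos hmpos), min_le_left _ _,
        fun j ↦ lt_of_le_of_lt (min_le_right _ _) ?_⟩
      have : m ≤ δ j := Finset.inf'_le δ (Finset.mem_univ j)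
      linarith [hδ j]
  refine ⟨w, fun j ↦ p j - c j, hw0, fun j ↦ ?_, fun j x hx ↦ hoff j x ?_⟩
  · have h1 := (hpI j).1
    have h2 := (hpI j).2
    have : |p j - c j| < 1 / 2 := abs_sub_lt_iff.2 ⟨by linarith, by linarith⟩
    linarith
  · rw [Real.dist_eq, abs_sub_lt_iff]
    constructor <;> linarith [hx.1, hx.2, hwδ j]

/-! ## The radial coordinate of the picture along a model knot -/

/-- `Re z` along the knot is a smooth function of the angle. [folklore] -/
theorem contDiff_re_zC_comp {K : 𝕊 1 → 𝔼 4} (hK : IsModelKnot r K) :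
    ContDiff ℝ ∞ fun θ : ℝ ↦ (zC (K (circlePoint θ))).re := by
  have hc : ContDiff ℝ ∞ fun θ ↦ K (circlePoint θ) :=
    contMDiff_iff_contDiff.1 (hK.1.comp contMDiff_circlePoint)
  exact Complex.reCLM.contDiff.comp (contDiff_zC.comp hc)

/-- `Re z` along the knot is `2π`-periodic, and so is its derivative. [folklore] -/
theorem periodic_re_zC_comp (K : 𝕊 1 → 𝔼 4) :
    Periodic (fun θ : ℝ ↦ (zC (K (circlePoint θ))).re) (2 * Real.pi) := fun θ ↦ by
  simp only [circlePoint_add_two_pi]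

/-- **The critical values of `Re z` along the knot form a compact Lebesgue-null set.**
[folklore] -/
theorem isCompact_criticalValues_re_zC {K : 𝕊 1 → 𝔼 4} (hK : IsModelKnot r K) :
    IsCompact ((fun θ : ℝ ↦ (zC (K (circlePoint θ))).re) ''
      {θ | θ ∈ Icc 0 (2 * Real.pi) ∧ deriv (fun θ : ℝ ↦ (zC (K (circlePoint θ))).re) θ = 0}) := by
  have hf := contDiff_re_zC_comp hK
  have hcl : IsClosed {θ : ℝ | θ ∈ Icc 0 (2 * Real.pi) ∧
      deriv (fun θ : ℝ ↦ (zC (K (circlePoint θ))).re) θ = 0} := by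
    rw [setOf_and]
    exact isClosed_Icc.inter (isClosed_eq (hf.continuous_deriv (by simp)) continuous_const)
  exact (isCompact_Icc.of_isClosed_subset hcl fun θ hθ ↦ hθ.1).image hf.continuous

/-- Every critical value is attained at a critical point of the period window (periodicity).
[folklore] -/
theorem criticalValues_re_zC_eq (K : 𝕊 1 → 𝔼 4) :
    (fun θ : ℝ ↦ (zC (K (circlePoint θ))).re) ''
        {θ | deriv (fun θ : ℝ ↦ (zC (K (circlePoint θ))).re) θ = 0} =
      (fun θ : ℝ ↦ (zC (K (circlePoint θ))).re) ''
        {θ | θ ∈ Icc 0 (2 * Real.pi) ∧ deriv (fun θ : ℝ ↦ (zC (K (circlePoint θ))).re) θ = 0} := by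
  set f : ℝ → ℝ := fun θ ↦ (zC (K (circlePoint θ))).re with hf
  have hper : Periodic f (2 * Real.pi) := periodic_re_zC_comp K
  have hper' : Periodic (deriv f) (2 * Real.pi) := fun θ ↦ by
    rw [← deriv_comp_add_const]
    exact congrArg (fun g ↦ deriv g θ) (funext hper)
  apply Subset.antisymm
  · rintro _ ⟨θ, hθ, rfl⟩
    refine ⟨toIcoMod Real.two_pi_pos 0 θ, ⟨?_, ?_⟩, ?_⟩
    · have h1 := toIcoMod_mem_Ico Real.two_pi_pos 0 θ
      rw [zero_add] at h1
      exact Ico_subset_Icc_self h1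
    · show deriv f (toIcoMod Real.two_pi_pos 0 θ) = 0
      rw [← self_sub_toIcoDiv_zsmul, hper'.sub_zsmul_eq]
      exact hθ
    · show f (toIcoMod Real.two_pi_pos 0 θ) = f θ
      rw [← self_sub_toIcoDiv_zsmul, hper.sub_zsmul_eq]
  · rintro _ ⟨θ, hθ, rfl⟩
    exact ⟨θ, hθ.2, rfl⟩

/-! ## Generic bands -/

/-- **Generic bands exist.**  For a model knot `K` and a knot `K₃` of the tree in general
position (its picture `D(0⃗)(K)`, `⇑K₃ = finiteApprox r 0 K`, in the application) there are
offsets `e_j` and a half-width `w > 0` with `|e_j| + w < 1` such that, for every hole `j`, the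
window `[c_j + e_j - w, c_j + e_j + w]` of values of `Re z` contains neither the value of `Re z`
at any crossing parameter of `K₃` (`Knot.crossingSet`, a finite set) nor any critical value of
`θ ↦ Re z(K(cos θ, sin θ))` (a compact null set, Sard): the ring of band `j` in the annular
picture meets the diagram away from its crossings and in radially monotone arcs.
[cite: ManolescuMarengonSarkarWillis2023, §8.1] -/
theorem exists_generic_bands {K : 𝕊 1 → 𝔼 4} (hK : IsModelKnot r K) {K₃ : Knot}
    (hgp : K₃.InGeneralPosition) :
    ∃ (w : ℝ) (e : Fin r → ℝ), 0 < w ∧ (∀ j, |e j| + w < 1) ∧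
      (∀ j : Fin r, ∀ s ∈ Knot.crossingSet K₃, (zC (K (circlePoint s))).re ∉
        Icc ((holeCentre r j).re + e j - w) ((holeCentre r j).re + e j + w)) ∧
      (∀ (j : Fin r) (θ : ℝ), deriv (fun θ : ℝ ↦ (zC (K (circlePoint θ))).re) θ = 0 →
        (zC (K (circlePoint θ))).re ∉
          Icc ((holeCentre r j).re + e j - w) ((holeCentre r j).re + e j + w)) := by
  set f : ℝ → ℝ := fun θ ↦ (zC (K (circlePoint θ))).re with hf
  have hfd : Differentiable ℝ f := (contDiff_re_zC_comp hK).differentiable (by simp)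
  -- the bad set: critical values and crossing values
  set S : Set ℝ := f '' {θ | θ ∈ Icc 0 (2 * Real.pi) ∧ deriv f θ = 0} ∪
    f '' Knot.crossingSet K₃ with hS
  have hfin : (f '' Knot.crossingSet K₃).Finite := hgp.finite_crossingSet.image f
  have hSc : IsClosed S :=
    (isCompact_criticalValues_re_zC hK).isClosed.union hfin.isClosed
  have hS0 : volume S = 0 := by
    refine measure_union_null ?_ (hfin.measure_zero volume)
    rw [← criticalValues_re_zC_eq K]
    exact volume_image_setOf_deriv_eq_zero hfd
  obtain ⟨w, e, hw, he, hoff⟩ := exists_bands_avoiding (fun j : Fin r ↦ (holeCentre r j).re) hSc hS0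
  refine ⟨w, e, hw, he, fun j s hs hmem ↦ hoff j _ hmem (Or.inr ⟨s, hs, rfl⟩),
    fun j θ hθ hmem ↦ hoff j _ hmem (Or.inl ?_)⟩
  rw [← criticalValues_re_zC_eq K]
  exact ⟨θ, hθ, rfl⟩

end MMSW

end Literature.Topology.FourManifolds

end
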